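import Summits.CriticalPhenomena.PercolationContinuityZ3.Theorems.PercNearOneGluingNoHeavyLowerTailSuperTerminalQuarticHubCylinders
import HarnessLib

/-!
# Four-terminal hub graphs: the terminal pairs as one piece (THEOREM H4, part 4a — towards the full vertex-cover class)

Support file for crux `stmt-CriticalPhenomena-4575` (`NoHeavyLowerTail`), seat `prim-facecert` gen 21 (`--supports stmt-CriticalPhenomena-4575`);
memo `run/shared/lean/prim/prim-l12/prim-facecert/FINDING-gen21-V4-HUB-GRAPHS.md` §8.  No sorries, standard axioms.

With terminal–terminal pairs of arbitrary weight the six pairs among `c u a b` form ONE more piece of the product structure (the "terminal piece").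
This file computes the probabilities of its events in closed form — products of `1 − w` over explicit lists of terminal pairs (`real_closed_list`,
`nodup_termPairs`), and the two Boolean combinations entering the disjoint-events bound — the admissibility of the terminal piece
(the three one-piece inequalities) is `…SuperTerminalQuarticTermPiece.termPiece`.  [this work]
-/

namespace Summit.CriticalPhenomena.PercolationContinuityZ3.Theorems.SuperTerminalQuarticTermPairs

open MeasureTheory Set Finset
open Literature.Probability.Percolation Literature.Probability.LatticeModels
open Summit.CriticalPhenomena.PercolationContinuityZ3.Theorems.SuperTerminalQuarticHubEvents
open scoped Classical

variable {V : Type*}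

/-! ## Distinct terminal pairs and list products -/

/-- Two pairs on four pairwise distinct points are distinct unless they have the same endpoints. [this work] -/
theorem pair_ne {x y x' y' : V} (h1 : x ≠ x' ∨ y ≠ y') (h2 : x ≠ y' ∨ y ≠ x') : s(x, y) ≠ s(x', y') := by
  intro e
  rcases Sym2.eq_iff.1 e with ⟨e1, e2⟩ | ⟨e1, e2⟩
  · rcases h1 with h | h
    · exact h e1
    · exact h e2
  · rcases h2 with h | h
    · exact h e1
    · exact h e2

/-- `P(every pair of a duplicate-free list is closed) = Π (1 − w)`. [this work] -/
theorem real_closed_list [DecidableEq V] (w : Sym2 V → unitInterval) {l : List (Sym2 V)} (hl : l.Nodup) :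
    (prodBernoulli w).real {ω : BondConfig V | ∀ e ∈ l, e ∉ ω} = (l.map fun e => 1 - (w e : ℝ)).prod := by
  have hset : {ω : BondConfig V | ∀ e ∈ l, e ∉ ω} = {ω | ∀ e ∈ l.toFinset, e ∉ ω} := by
    ext ω; simp only [mem_setOf_eq, List.mem_toFinset]
  rw [hset, prodBernoulli_real_forall_notMem, List.prod_toFinset _ hl]

/-- `P(every pair of a duplicate-free list is open) = Π w`. [this work] -/
theorem real_open_list [DecidableEq V] (w : Sym2 V → unitInterval) {l : List (Sym2 V)} (hl : l.Nodup) :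
    (prodBernoulli w).real {ω : BondConfig V | ∀ e ∈ l, e ∈ ω} = (l.map fun e => (w e : ℝ)).prod := by
  have hset : {ω : BondConfig V | ∀ e ∈ l, e ∈ ω} = {ω | (↑l.toFinset : Set (Sym2 V)) ⊆ ω} := by
    ext ω
    simp only [mem_setOf_eq, List.coe_toFinset, Set.subset_def]
  rw [hset, prodBernoulli_real_subset, List.prod_toFinset _ hl]

section termsets
variable [DecidableEq V] {c u a b : V}

omit [DecidableEq V] in
/-- The fifteen inequalities between the six terminal pairs (pairwise distinct terminals). [this work] -/
theorem termPairs_ne (hcu : c ≠ u) (hca : c ≠ a) (hcb : c ≠ b) (hua : u ≠ a) (hub : u ≠ b) (hab : a ≠ b) :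
    s(c, u) ≠ s(c, a) ∧ s(c, u) ≠ s(c, b) ∧ s(c, u) ≠ s(u, a) ∧ s(c, u) ≠ s(u, b) ∧ s(c, u) ≠ s(a, b) ∧
    s(c, a) ≠ s(c, b) ∧ s(c, a) ≠ s(u, a) ∧ s(c, a) ≠ s(u, b) ∧ s(c, a) ≠ s(a, b) ∧
    s(c, b) ≠ s(u, a) ∧ s(c, b) ≠ s(u, b) ∧ s(c, b) ≠ s(a, b) ∧
    s(u, a) ≠ s(u, b) ∧ s(u, a) ≠ s(a, b) ∧ s(u, b) ≠ s(a, b) :=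
  ⟨pair_ne (Or.inr hua) (Or.inr (Ne.symm hcu)), pair_ne (Or.inr hub) (Or.inr (Ne.symm hcu)), pair_ne (Or.inl hcu) (Or.inl hca),
    pair_ne (Or.inl hcu) (Or.inl hcb), pair_ne (Or.inl hca) (Or.inl hcb),
    pair_ne (Or.inr hab) (Or.inr (Ne.symm hca)), pair_ne (Or.inl hcu) (Or.inr (Ne.symm hua)), pair_ne (Or.inl hcu) (Or.inl hcb),
    pair_ne (Or.inl hca) (Or.inl hcb),
    pair_ne (Or.inl hcu) (Or.inl hca), pair_ne (Or.inl hcu) (Or.inl hcb), pair_ne (Or.inl hca) (Or.inl hcb),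
    pair_ne (Or.inr hab) (Or.inr (Ne.symm hua)), pair_ne (Or.inl hua) (Or.inl hub), pair_ne (Or.inl hua) (Or.inl hub)⟩

/-- `tSep {c}` = the three pairs at `c` are closed. [this work] -/
theorem mem_tSep_c (hcu : c ≠ u) (hca : c ≠ a) (hcb : c ≠ b) (hua : u ≠ a) (hub : u ≠ b) (hab : a ≠ b) {ω : BondConfig V} :
    ω ∈ tSep {c} c u a b ↔ s(c, u) ∉ ω ∧ s(c, a) ∉ ω ∧ s(c, b) ∉ ω := by
  simp only [tSep, mem_setOf_eq, Finset.mem_singleton, forall_eq, Finset.mem_sdiff, mem_terms4]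
  constructor
  · intro h
    exact ⟨h u ⟨Or.inr (Or.inl rfl), fun e => hcu e.symm⟩, h a ⟨Or.inr (Or.inr (Or.inl rfl)), fun e => hca e.symm⟩,
      h b ⟨Or.inr (Or.inr (Or.inr rfl)), fun e => hcb e.symm⟩⟩
  · rintro ⟨h1, h2, h3⟩ y ⟨hy, hyc⟩
    rcases hy with rfl | rfl | rfl | rfl
    · exact (hyc rfl).elim
    · exact h1
    · exact h2
    · exact h3

/-- `tSep {b}` = the three pairs at `b` are closed (canonical orientations). [this work] -/
theorem mem_tSep_b (hcu : c ≠ u) (hca : c ≠ a) (hcb : c ≠ b) (hua : u ≠ a) (hub : u ≠ b) (hab : a ≠ b) {ω : BondConfig V} :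
    ω ∈ tSep {b} c u a b ↔ s(c, b) ∉ ω ∧ s(u, b) ∉ ω ∧ s(a, b) ∉ ω := by
  simp only [tSep, mem_setOf_eq, Finset.mem_singleton, forall_eq, Finset.mem_sdiff, mem_terms4]
  constructor
  · intro h
    refine ⟨?_, ?_, ?_⟩
    · rw [Sym2.eq_swap]; exact h c ⟨Or.inl rfl, hcb⟩
    · rw [Sym2.eq_swap]; exact h u ⟨Or.inr (Or.inl rfl), hub⟩
    · rw [Sym2.eq_swap]; exact h a ⟨Or.inr (Or.inr (Or.inl rfl)), hab⟩
  · rintro ⟨h1, h2, h3⟩ y ⟨hy, hyb⟩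
    rcases hy with rfl | rfl | rfl | rfl
    · rw [Sym2.eq_swap]; exact h1
    · rw [Sym2.eq_swap]; exact h2
    · rw [Sym2.eq_swap]; exact h3
    · exact (hyb rfl).elim

/-- `tSep {u}` unfolded (canonical orientations). [this work] -/
theorem mem_tSep_u (hcu : c ≠ u) (hca : c ≠ a) (hcb : c ≠ b) (hua : u ≠ a) (hub : u ≠ b) (hab : a ≠ b) {ω : BondConfig V} :
    ω ∈ tSep {u} c u a b ↔ s(c, u) ∉ ω ∧ s(u, a) ∉ ω ∧ s(u, b) ∉ ω := by
  simp only [tSep, mem_setOf_eq, Finset.mem_singleton, forall_eq, Finset.mem_sdiff, mem_terms4]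
  constructor
  · intro h
    refine ⟨?_, h a ⟨Or.inr (Or.inr (Or.inl rfl)), fun e => hua e.symm⟩, h b ⟨Or.inr (Or.inr (Or.inr rfl)), fun e => hub e.symm⟩⟩
    rw [Sym2.eq_swap]; exact h c ⟨Or.inl rfl, hcu⟩
  · rintro ⟨h1, h2, h3⟩ y ⟨hy, hyu⟩
    rcases hy with rfl | rfl | rfl | rfl
    · rw [Sym2.eq_swap]; exact h1
    · exact (hyu rfl).elim
    · exact h2
    · exact h3

/-- `tSep {a}` unfolded (canonical orientations). [this work] -/
theorem mem_tSep_a (hcu : c ≠ u) (hca : c ≠ a) (hcb : c ≠ b) (hua : u ≠ a) (hub : u ≠ b) (hab : a ≠ b) {ω : BondConfig V} :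
    ω ∈ tSep {a} c u a b ↔ s(c, a) ∉ ω ∧ s(u, a) ∉ ω ∧ s(a, b) ∉ ω := by
  simp only [tSep, mem_setOf_eq, Finset.mem_singleton, forall_eq, Finset.mem_sdiff, mem_terms4]
  constructor
  · intro h
    refine ⟨?_, ?_, h b ⟨Or.inr (Or.inr (Or.inr rfl)), fun e => hab e.symm⟩⟩
    · rw [Sym2.eq_swap]; exact h c ⟨Or.inl rfl, hca⟩
    · rw [Sym2.eq_swap]; exact h u ⟨Or.inr (Or.inl rfl), hua⟩
  · rintro ⟨h1, h2, h3⟩ y ⟨hy, hya⟩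
    rcases hy with rfl | rfl | rfl | rfl
    · rw [Sym2.eq_swap]; exact h1
    · rw [Sym2.eq_swap]; exact h2
    · exact (hya rfl).elim
    · exact h3

/-- `tSep {u, a}` unfolded (canonical orientations). [this work] -/
theorem mem_tSep_ua (hcu : c ≠ u) (hca : c ≠ a) (hcb : c ≠ b) (hua : u ≠ a) (hub : u ≠ b) (hab : a ≠ b) {ω : BondConfig V} :
    ω ∈ tSep {u, a} c u a b ↔ (s(c, u) ∉ ω ∧ s(u, b) ∉ ω) ∧ (s(c, a) ∉ ω ∧ s(a, b) ∉ ω) := by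
  simp only [tSep, mem_setOf_eq, Finset.mem_insert, Finset.mem_singleton, forall_eq_or_imp, forall_eq, Finset.mem_sdiff, mem_terms4,
    not_or]
  constructor
  · rintro ⟨h1, h2⟩
    refine ⟨⟨?_, h1 b ⟨Or.inr (Or.inr (Or.inr rfl)), Ne.symm hub, Ne.symm hab⟩⟩, ?_, h2 b ⟨Or.inr (Or.inr (Or.inr rfl)), Ne.symm hub, Ne.symm hab⟩⟩
    · rw [Sym2.eq_swap]; exact h1 c ⟨Or.inl rfl, hcu, hca⟩
    · rw [Sym2.eq_swap]; exact h2 c ⟨Or.inl rfl, hcu, hca⟩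
  · rintro ⟨⟨h1, h2⟩, ⟨h3, h4⟩⟩
    refine ⟨fun y ⟨hy, hyu, hya⟩ => ?_, fun y ⟨hy, hyu, hya⟩ => ?_⟩
    · rcases hy with rfl | rfl | rfl | rfl
      · rw [Sym2.eq_swap]; exact h1
      · exact (hyu rfl).elim
      · exact (hya rfl).elim
      · exact h2
    · rcases hy with rfl | rfl | rfl | rfl
      · rw [Sym2.eq_swap]; exact h3
      · exact (hyu rfl).elim
      · exact (hya rfl).elim
      · exact h4

end termsets

/-! ## Probabilities of the terminal events -/

section termprobs
set_option linter.unusedSimpArgs false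
variable [DecidableEq V] (w : Sym2 V → unitInterval) {c u a b : V}

/-- `P(tSep{c} ∩ tSep{b}) = (1−w cu)(1−w ca)(1−w cb)(1−w ub)(1−w ab)`. [this work] -/
theorem real_T_cb (hcu : c ≠ u) (hca : c ≠ a) (hcb : c ≠ b) (hua : u ≠ a) (hub : u ≠ b) (hab : a ≠ b) :
    (prodBernoulli w).real (tSep {c} c u a b ∩ tSep {b} c u a b) = (1 - (w s(c, u) : ℝ)) * (1 - (w s(c, a) : ℝ)) * (1 - (w s(c, b) : ℝ)) * (1 - (w s(u, b) : ℝ)) * (1 - (w s(a, b) : ℝ)) := by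
  obtain ⟨n1, n2, n3, n4, n5, n6, n7, n8, n9, n10, n11, n12, n13, n14, n15⟩ := termPairs_ne hcu hca hcb hua hub hab
  have hset : tSep {c} c u a b ∩ tSep {b} c u a b =
      {ω : BondConfig V | ∀ e ∈ [s(c, u), s(c, a), s(c, b), s(u, b), s(a, b)], e ∉ ω} := by
    ext ω
    simp only [mem_inter_iff, mem_tSep_c hcu hca hcb hua hub hab, mem_tSep_b hcu hca hcb hua hub hab, mem_setOf_eq, List.forall_mem_cons,
      List.forall_mem_nil, List.not_mem_nil, IsEmpty.forall_iff, and_true, implies_true]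
    tauto
  rw [hset, real_closed_list w (by simp [List.nodup_cons, n1, n2, n3, n4, n5, n6, n7, n8, n9, n10, n11, n12, n13, n14, n15, Ne.symm n1, Ne.symm n2, Ne.symm n3, Ne.symm n4, Ne.symm n5, Ne.symm n6, Ne.symm n7, Ne.symm n8, Ne.symm n9, Ne.symm n10, Ne.symm n11, Ne.symm n12, Ne.symm n13, Ne.symm n14, Ne.symm n15])]
  simp only [List.map_cons, List.map_nil, List.prod_cons, List.prod_nil, mul_one]
  ring

/-- `P(tSep{c} ∩ tSep{b} ∩ tSep{u}) = Π over all six pairs of (1−w)`. [this work] -/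
theorem real_T_cbu (hcu : c ≠ u) (hca : c ≠ a) (hcb : c ≠ b) (hua : u ≠ a) (hub : u ≠ b) (hab : a ≠ b) :
    (prodBernoulli w).real (tSep {c} c u a b ∩ tSep {b} c u a b ∩ tSep {u} c u a b) =
      (1 - (w s(c, u) : ℝ)) * (1 - (w s(c, a) : ℝ)) * (1 - (w s(c, b) : ℝ)) * (1 - (w s(u, a) : ℝ)) * (1 - (w s(u, b) : ℝ)) * (1 - (w s(a, b) : ℝ)) := by
  obtain ⟨n1, n2, n3, n4, n5, n6, n7, n8, n9, n10, n11, n12, n13, n14, n15⟩ := termPairs_ne hcu hca hcb hua hub hab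
  have hset : tSep {c} c u a b ∩ tSep {b} c u a b ∩ tSep {u} c u a b =
      {ω : BondConfig V | ∀ e ∈ [s(c, u), s(c, a), s(c, b), s(u, a), s(u, b), s(a, b)], e ∉ ω} := by
    ext ω
    simp only [mem_inter_iff, mem_tSep_c hcu hca hcb hua hub hab, mem_tSep_b hcu hca hcb hua hub hab, mem_tSep_u hcu hca hcb hua hub hab, mem_setOf_eq, List.forall_mem_cons,
      List.forall_mem_nil, List.not_mem_nil, IsEmpty.forall_iff, and_true, implies_true]
    tauto
  rw [hset, real_closed_list w (by simp [List.nodup_cons, n1, n2, n3, n4, n5, n6, n7, n8, n9, n10, n11, n12, n13, n14, n15, Ne.symm n1, Ne.symm n2, Ne.symm n3, Ne.symm n4, Ne.symm n5, Ne.symm n6, Ne.symm n7, Ne.symm n8, Ne.symm n9, Ne.symm n10, Ne.symm n11, Ne.symm n12, Ne.symm n13, Ne.symm n14, Ne.symm n15])]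
  simp only [List.map_cons, List.map_nil, List.prod_cons, List.prod_nil, mul_one]
  ring

/-- `P(tSep{u,a}) = (1−w cu)(1−w ca)(1−w ub)(1−w ab)`. [this work] -/
theorem real_T_ua (hcu : c ≠ u) (hca : c ≠ a) (hcb : c ≠ b) (hua : u ≠ a) (hub : u ≠ b) (hab : a ≠ b) :
    (prodBernoulli w).real (tSep {u, a} c u a b) = (1 - (w s(c, u) : ℝ)) * (1 - (w s(c, a) : ℝ)) * (1 - (w s(u, b) : ℝ)) * (1 - (w s(a, b) : ℝ)) := by
  obtain ⟨n1, n2, n3, n4, n5, n6, n7, n8, n9, n10, n11, n12, n13, n14, n15⟩ := termPairs_ne hcu hca hcb hua hub hab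
  have hset : tSep {u, a} c u a b = {ω : BondConfig V | ∀ e ∈ [s(c, u), s(c, a), s(u, b), s(a, b)], e ∉ ω} := by
    ext ω
    simp only [mem_tSep_ua hcu hca hcb hua hub hab, mem_setOf_eq, List.forall_mem_cons, List.forall_mem_nil, List.not_mem_nil, IsEmpty.forall_iff, and_true, implies_true]
    tauto
  rw [hset, real_closed_list w (by simp [List.nodup_cons, n1, n2, n3, n4, n5, n6, n7, n8, n9, n10, n11, n12, n13, n14, n15, Ne.symm n1, Ne.symm n2, Ne.symm n3, Ne.symm n4, Ne.symm n5, Ne.symm n6, Ne.symm n7, Ne.symm n8, Ne.symm n9, Ne.symm n10, Ne.symm n11, Ne.symm n12, Ne.symm n13, Ne.symm n14, Ne.symm n15])]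
  simp only [List.map_cons, List.map_nil, List.prod_cons, List.prod_nil, mul_one]
  ring

/-- `P(tSep{u} ∩ tSep{a}) = (1−w cu)(1−w ca)(1−w ua)(1−w ub)(1−w ab)`. [this work] -/
theorem real_T_u_a (hcu : c ≠ u) (hca : c ≠ a) (hcb : c ≠ b) (hua : u ≠ a) (hub : u ≠ b) (hab : a ≠ b) :
    (prodBernoulli w).real (tSep {u} c u a b ∩ tSep {a} c u a b) = (1 - (w s(c, u) : ℝ)) * (1 - (w s(c, a) : ℝ)) * (1 - (w s(u, a) : ℝ)) * (1 - (w s(u, b) : ℝ)) * (1 - (w s(a, b) : ℝ)) := by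
  obtain ⟨n1, n2, n3, n4, n5, n6, n7, n8, n9, n10, n11, n12, n13, n14, n15⟩ := termPairs_ne hcu hca hcb hua hub hab
  have hset : tSep {u} c u a b ∩ tSep {a} c u a b =
      {ω : BondConfig V | ∀ e ∈ [s(c, u), s(c, a), s(u, a), s(u, b), s(a, b)], e ∉ ω} := by
    ext ω
    simp only [mem_inter_iff, mem_tSep_u hcu hca hcb hua hub hab, mem_tSep_a hcu hca hcb hua hub hab, mem_setOf_eq, List.forall_mem_cons, List.forall_mem_nil, List.not_mem_nil,
      IsEmpty.forall_iff, and_true, implies_true]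
    tauto
  rw [hset, real_closed_list w (by simp [List.nodup_cons, n1, n2, n3, n4, n5, n6, n7, n8, n9, n10, n11, n12, n13, n14, n15, Ne.symm n1, Ne.symm n2, Ne.symm n3, Ne.symm n4, Ne.symm n5, Ne.symm n6, Ne.symm n7, Ne.symm n8, Ne.symm n9, Ne.symm n10, Ne.symm n11, Ne.symm n12, Ne.symm n13, Ne.symm n14, Ne.symm n15])]
  simp only [List.map_cons, List.map_nil, List.prod_cons, List.prod_nil, mul_one]
  ring

/-- `P(tSep{c}) = (1−w cu)(1−w ca)(1−w cb)`. [this work] -/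
theorem real_T_c (hcu : c ≠ u) (hca : c ≠ a) (hcb : c ≠ b) (hua : u ≠ a) (hub : u ≠ b) (hab : a ≠ b) :
    (prodBernoulli w).real (tSep {c} c u a b) = (1 - (w s(c, u) : ℝ)) * (1 - (w s(c, a) : ℝ)) * (1 - (w s(c, b) : ℝ)) := by
  obtain ⟨n1, n2, n3, n4, n5, n6, n7, n8, n9, n10, n11, n12, n13, n14, n15⟩ := termPairs_ne hcu hca hcb hua hub hab
  have hset : tSep {c} c u a b = {ω : BondConfig V | ∀ e ∈ [s(c, u), s(c, a), s(c, b)], e ∉ ω} := by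
    ext ω
    simp only [mem_tSep_c hcu hca hcb hua hub hab, mem_setOf_eq, List.forall_mem_cons, List.forall_mem_nil, List.not_mem_nil, IsEmpty.forall_iff, and_true, implies_true]
  rw [hset, real_closed_list w (by simp [List.nodup_cons, n1, n2, n3, n4, n5, n6, n7, n8, n9, n10, n11, n12, n13, n14, n15, Ne.symm n1, Ne.symm n2, Ne.symm n3, Ne.symm n4, Ne.symm n5, Ne.symm n6, Ne.symm n7, Ne.symm n8, Ne.symm n9, Ne.symm n10, Ne.symm n11, Ne.symm n12, Ne.symm n13, Ne.symm n14, Ne.symm n15])]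
  simp only [List.map_cons, List.map_nil, List.prod_cons, List.prod_nil, mul_one]
  ring

/-- `P(tSep{b}) = (1−w cb)(1−w ub)(1−w ab)` (= `mB` of the terminal piece). [this work] -/
theorem real_T_b (hcu : c ≠ u) (hca : c ≠ a) (hcb : c ≠ b) (hua : u ≠ a) (hub : u ≠ b) (hab : a ≠ b) :
    (prodBernoulli w).real (tSep {b} c u a b) = (1 - (w s(c, b) : ℝ)) * (1 - (w s(u, b) : ℝ)) * (1 - (w s(a, b) : ℝ)) := by
  obtain ⟨n1, n2, n3, n4, n5, n6, n7, n8, n9, n10, n11, n12, n13, n14, n15⟩ := termPairs_ne hcu hca hcb hua hub hab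
  have hset : tSep {b} c u a b = {ω : BondConfig V | ∀ e ∈ [s(c, b), s(u, b), s(a, b)], e ∉ ω} := by
    ext ω
    simp only [mem_tSep_b hcu hca hcb hua hub hab, mem_setOf_eq, List.forall_mem_cons, List.forall_mem_nil, List.not_mem_nil, IsEmpty.forall_iff, and_true, implies_true]
  rw [hset, real_closed_list w (by simp [List.nodup_cons, n1, n2, n3, n4, n5, n6, n7, n8, n9, n10, n11, n12, n13, n14, n15, Ne.symm n1, Ne.symm n2, Ne.symm n3, Ne.symm n4, Ne.symm n5, Ne.symm n6, Ne.symm n7, Ne.symm n8, Ne.symm n9, Ne.symm n10, Ne.symm n11, Ne.symm n12, Ne.symm n13, Ne.symm n14, Ne.symm n15])]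
  simp only [List.map_cons, List.map_nil, List.prod_cons, List.prod_nil, mul_one]
  ring

/-- `P(s(c,u), s(c,a) both open) = w cu · w ca`. [this work] -/
theorem real_cu_ca (hcu : c ≠ u) (hca : c ≠ a) (hcb : c ≠ b) (hua : u ≠ a) (hub : u ≠ b) (hab : a ≠ b) :
    (prodBernoulli w).real {ω : BondConfig V | s(c, u) ∈ ω ∧ s(c, a) ∈ ω} = (w s(c, u) : ℝ) * (w s(c, a) : ℝ) := by
  obtain ⟨n1, -⟩ := termPairs_ne hcu hca hcb hua hub hab
  have hset : {ω : BondConfig V | s(c, u) ∈ ω ∧ s(c, a) ∈ ω} = {ω | ∀ e ∈ [s(c, u), s(c, a)], e ∈ ω} := by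
    ext ω; simp
  rw [hset, real_open_list w (by simp [n1])]
  simp

variable [Fintype V]

/-- The prefix event of the terminal piece: `cb, ub, ab, ua` closed and not both `cu, ca` open; probability
`(1−w cb)(1−w ub)(1−w ab)(1−w ua)(1 − w cu · w ca)`. [this work] -/
theorem real_T_pre (hcu : c ≠ u) (hca : c ≠ a) (hcb : c ≠ b) (hua : u ≠ a) (hub : u ≠ b) (hab : a ≠ b) :
    (prodBernoulli w).real ({ω : BondConfig V | s(c, b) ∉ ω ∧ s(u, b) ∉ ω ∧ s(a, b) ∉ ω ∧ s(u, a) ∉ ω} ∩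
        {ω | ¬ (s(c, u) ∈ ω ∧ s(c, a) ∈ ω)}) =
      (1 - (w s(c, b) : ℝ)) * (1 - (w s(u, b) : ℝ)) * (1 - (w s(a, b) : ℝ)) * (1 - (w s(u, a) : ℝ)) * (1 - (w s(c, u) : ℝ) * (w s(c, a) : ℝ)) := by
  obtain ⟨n1, n2, n3, n4, n5, n6, n7, n8, n9, n10, n11, n12, n13, n14, n15⟩ := termPairs_ne hcu hca hcb hua hub hab
  have hdisj : Disjoint ({s(c, b), s(u, b), s(a, b), s(u, a)} : Finset (Sym2 V)) {s(c, u), s(c, a)} := by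
    simp [Finset.disjoint_left, n1, n2, n3, n4, n5, n6, n7, n8, n9, n10, n11, n12, n13, n14, n15, Ne.symm n1, Ne.symm n2, Ne.symm n3, Ne.symm n4, Ne.symm n5, Ne.symm n6, Ne.symm n7, Ne.symm n8, Ne.symm n9, Ne.symm n10, Ne.symm n11, Ne.symm n12, Ne.symm n13, Ne.symm n14, Ne.symm n15]
  have hA : DeterminedBy {ω : BondConfig V | s(c, b) ∉ ω ∧ s(u, b) ∉ ω ∧ s(a, b) ∉ ω ∧ s(u, a) ∉ ω}
      (↑({s(c, b), s(u, b), s(a, b), s(u, a)} : Finset (Sym2 V)) : Set (Sym2 V)) :=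
    ThreePointHubEvents.determinedBy_of_iff fun ω ω' hF => by
      simp only [mem_setOf_eq]; rw [hF _ (by simp), hF _ (by simp), hF _ (by simp), hF s(u, a) (by simp)]
  have hB : DeterminedBy {ω : BondConfig V | ¬ (s(c, u) ∈ ω ∧ s(c, a) ∈ ω)} (↑({s(c, u), s(c, a)} : Finset (Sym2 V)) : Set (Sym2 V)) :=
    ThreePointHubEvents.determinedBy_of_iff fun ω ω' hF => by
      simp only [mem_setOf_eq]; rw [hF _ (by simp), hF s(c, a) (by simp)]
  rw [prodBernoulli_real_inter_of_determinedBy_disjoint w hdisj hA hB MeasurableSet.of_discrete MeasurableSet.of_discrete]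
  have h1 : (prodBernoulli w).real {ω : BondConfig V | s(c, b) ∉ ω ∧ s(u, b) ∉ ω ∧ s(a, b) ∉ ω ∧ s(u, a) ∉ ω} =
      (1 - (w s(c, b) : ℝ)) * (1 - (w s(u, b) : ℝ)) * (1 - (w s(a, b) : ℝ)) * (1 - (w s(u, a) : ℝ)) := by
    have hset : {ω : BondConfig V | s(c, b) ∉ ω ∧ s(u, b) ∉ ω ∧ s(a, b) ∉ ω ∧ s(u, a) ∉ ω} =
        {ω | ∀ e ∈ [s(c, b), s(u, b), s(a, b), s(u, a)], e ∉ ω} := by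
      ext ω; simp only [mem_setOf_eq, List.forall_mem_cons, List.forall_mem_nil, List.not_mem_nil, IsEmpty.forall_iff, and_true, implies_true]
    rw [hset, real_closed_list w (by simp [List.nodup_cons, n1, n2, n3, n4, n5, n6, n7, n8, n9, n10, n11, n12, n13, n14, n15, Ne.symm n1, Ne.symm n2, Ne.symm n3, Ne.symm n4, Ne.symm n5, Ne.symm n6, Ne.symm n7, Ne.symm n8, Ne.symm n9, Ne.symm n10, Ne.symm n11, Ne.symm n12, Ne.symm n13, Ne.symm n14, Ne.symm n15])]
    simp only [List.map_cons, List.map_nil, List.prod_cons, List.prod_nil, mul_one]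
    ring
  have h2 : (prodBernoulli w).real {ω : BondConfig V | ¬ (s(c, u) ∈ ω ∧ s(c, a) ∈ ω)} = 1 - (w s(c, u) : ℝ) * (w s(c, a) : ℝ) := by
    have hset : {ω : BondConfig V | ¬ (s(c, u) ∈ ω ∧ s(c, a) ∈ ω)} = {ω : BondConfig V | s(c, u) ∈ ω ∧ s(c, a) ∈ ω}ᶜ := by
      ext ω; simp only [mem_setOf_eq, mem_compl_iff]
    rw [hset, probReal_compl_eq_one_sub MeasurableSet.of_discrete, real_cu_ca w hcu hca hcb hua hub hab]
  rw [h1, h2]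

/-- The creator event of the terminal piece: `cb, ub, ab` closed and (`ua` open or both `cu, ca` open); probability
`(1−w cb)(1−w ub)(1−w ab)(w ua + (1−w ua)·w cu·w ca)`. [this work] -/
theorem real_T_cre (hcu : c ≠ u) (hca : c ≠ a) (hcb : c ≠ b) (hua : u ≠ a) (hub : u ≠ b) (hab : a ≠ b) :
    (prodBernoulli w).real ({ω : BondConfig V | s(c, b) ∉ ω ∧ s(u, b) ∉ ω ∧ s(a, b) ∉ ω} ∩
        {ω | s(u, a) ∈ ω ∨ (s(c, u) ∈ ω ∧ s(c, a) ∈ ω)}) =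
      (1 - (w s(c, b) : ℝ)) * (1 - (w s(u, b) : ℝ)) * (1 - (w s(a, b) : ℝ)) * ((w s(u, a) : ℝ) + (1 - (w s(u, a) : ℝ)) * (w s(c, u) : ℝ) * (w s(c, a) : ℝ)) := by
  obtain ⟨n1, n2, n3, n4, n5, n6, n7, n8, n9, n10, n11, n12, n13, n14, n15⟩ := termPairs_ne hcu hca hcb hua hub hab
  have hdisj : Disjoint ({s(c, b), s(u, b), s(a, b)} : Finset (Sym2 V)) {s(u, a), s(c, u), s(c, a)} := by
    simp [Finset.disjoint_left, n1, n2, n3, n4, n5, n6, n7, n8, n9, n10, n11, n12, n13, n14, n15, Ne.symm n1, Ne.symm n2, Ne.symm n3, Ne.symm n4, Ne.symm n5, Ne.symm n6, Ne.symm n7, Ne.symm n8, Ne.symm n9, Ne.symm n10, Ne.symm n11, Ne.symm n12, Ne.symm n13, Ne.symm n14, Ne.symm n15]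
  have hA : DeterminedBy {ω : BondConfig V | s(c, b) ∉ ω ∧ s(u, b) ∉ ω ∧ s(a, b) ∉ ω}
      (↑({s(c, b), s(u, b), s(a, b)} : Finset (Sym2 V)) : Set (Sym2 V)) :=
    ThreePointHubEvents.determinedBy_of_iff fun ω ω' hF => by
      simp only [mem_setOf_eq]; rw [hF _ (by simp), hF _ (by simp), hF s(a, b) (by simp)]
  have hB : DeterminedBy {ω : BondConfig V | s(u, a) ∈ ω ∨ (s(c, u) ∈ ω ∧ s(c, a) ∈ ω)}
      (↑({s(u, a), s(c, u), s(c, a)} : Finset (Sym2 V)) : Set (Sym2 V)) :=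
    ThreePointHubEvents.determinedBy_of_iff fun ω ω' hF => by
      simp only [mem_setOf_eq]; rw [hF _ (by simp), hF _ (by simp), hF s(c, a) (by simp)]
  rw [prodBernoulli_real_inter_of_determinedBy_disjoint w hdisj hA hB MeasurableSet.of_discrete MeasurableSet.of_discrete]
  have h1 : (prodBernoulli w).real {ω : BondConfig V | s(c, b) ∉ ω ∧ s(u, b) ∉ ω ∧ s(a, b) ∉ ω} = (1 - (w s(c, b) : ℝ)) * (1 - (w s(u, b) : ℝ)) * (1 - (w s(a, b) : ℝ)) := by
    have hset : {ω : BondConfig V | s(c, b) ∉ ω ∧ s(u, b) ∉ ω ∧ s(a, b) ∉ ω} = {ω | ∀ e ∈ [s(c, b), s(u, b), s(a, b)], e ∉ ω} := by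
      ext ω; simp only [mem_setOf_eq, List.forall_mem_cons, List.forall_mem_nil, List.not_mem_nil, IsEmpty.forall_iff, and_true, implies_true]
    rw [hset, real_closed_list w (by simp [List.nodup_cons, n1, n2, n3, n4, n5, n6, n7, n8, n9, n10, n11, n12, n13, n14, n15, Ne.symm n1, Ne.symm n2, Ne.symm n3, Ne.symm n4, Ne.symm n5, Ne.symm n6, Ne.symm n7, Ne.symm n8, Ne.symm n9, Ne.symm n10, Ne.symm n11, Ne.symm n12, Ne.symm n13, Ne.symm n14, Ne.symm n15])]
    simp only [List.map_cons, List.map_nil, List.prod_cons, List.prod_nil, mul_one]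
    ring
  -- the second factor: complement of (`ua` closed and not both `cu, ca` open), independent pieces again
  have hdisj2 : Disjoint ({s(u, a)} : Finset (Sym2 V)) {s(c, u), s(c, a)} := by simp [Finset.disjoint_left, n1, n2, n3, n4, n5, n6, n7, n8, n9, n10, n11, n12, n13, n14, n15, Ne.symm n1, Ne.symm n2, Ne.symm n3, Ne.symm n4, Ne.symm n5, Ne.symm n6, Ne.symm n7, Ne.symm n8, Ne.symm n9, Ne.symm n10, Ne.symm n11, Ne.symm n12, Ne.symm n13, Ne.symm n14, Ne.symm n15]
  have hA2 : DeterminedBy {ω : BondConfig V | s(u, a) ∉ ω} (↑({s(u, a)} : Finset (Sym2 V)) : Set (Sym2 V)) :=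
    ThreePointHubEvents.determinedBy_of_iff fun ω ω' hF => by simp only [mem_setOf_eq]; rw [hF _ (by simp)]
  have hB2 : DeterminedBy {ω : BondConfig V | ¬ (s(c, u) ∈ ω ∧ s(c, a) ∈ ω)} (↑({s(c, u), s(c, a)} : Finset (Sym2 V)) : Set (Sym2 V)) :=
    ThreePointHubEvents.determinedBy_of_iff fun ω ω' hF => by
      simp only [mem_setOf_eq]; rw [hF _ (by simp), hF s(c, a) (by simp)]
  have h2 : (prodBernoulli w).real {ω : BondConfig V | s(u, a) ∈ ω ∨ (s(c, u) ∈ ω ∧ s(c, a) ∈ ω)} =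
      (w s(u, a) : ℝ) + (1 - (w s(u, a) : ℝ)) * (w s(c, u) : ℝ) * (w s(c, a) : ℝ) := by
    have hset : {ω : BondConfig V | s(u, a) ∈ ω ∨ (s(c, u) ∈ ω ∧ s(c, a) ∈ ω)} =
        ({ω : BondConfig V | s(u, a) ∉ ω} ∩ {ω | ¬ (s(c, u) ∈ ω ∧ s(c, a) ∈ ω)})ᶜ := by
      ext ω; simp only [mem_setOf_eq, mem_compl_iff, mem_inter_iff]; tauto
    have hc : {ω : BondConfig V | ¬ (s(c, u) ∈ ω ∧ s(c, a) ∈ ω)} = {ω : BondConfig V | s(c, u) ∈ ω ∧ s(c, a) ∈ ω}ᶜ := by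
      ext ω; simp only [mem_setOf_eq, mem_compl_iff]
    rw [hset, probReal_compl_eq_one_sub MeasurableSet.of_discrete,
      prodBernoulli_real_inter_of_determinedBy_disjoint w hdisj2 hA2 hB2 MeasurableSet.of_discrete MeasurableSet.of_discrete,
      prodBernoulli_real_setOf_notMem, hc, probReal_compl_eq_one_sub MeasurableSet.of_discrete, real_cu_ca w hcu hca hcb hua hub hab]
    ring
  rw [h1, h2]

end termprobs

end Summit.CriticalPhenomena.PercolationContinuityZ3.Theorems.SuperTerminalQuarticTermPairs
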